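import Summits.RiemannHypothesis.RiemannHypothesis.Theorems.GroundBartaEvenWinsBeyondArchDeflationRM75ZQ1g14A
import Summits.RiemannHypothesis.RiemannHypothesis.Theorems.GroundBartaEvenWinsBeyondArchDeflationRM75ZSharedB
import Summits.RiemannHypothesis.RiemannHypothesis.Theorems.GroundBartaEvenWinsBeyondArchDeflationRM75ZConstsA
import Summits.RiemannHypothesis.RiemannHypothesis.Theorems.GroundBartaEvenWinsBeyondArchDeflationPanelQLoc4
import HarnessLib

/-!
# RiemannHypothesis / GroundBarta — rung 4 (`EvenWinsBeyondArch`): R-layer certificate of cell `RM75Z` — vector 1, y-panels [14]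

Generated by `tools/rgen/gen.py panels 1` (prover B).  `q_{1,14} = 1.656e-10`
-/

set_option linter.dupNamespace false

noncomputable section

open MeasureTheory Set Filter intervalIntegral
open scoped Topology BigOperators

namespace Summit.RiemannHypothesis.RiemannHypothesis.Theorems.EvenWinsBeyondArch

open Literature.NumberTheory.LFunctions
open Literature.Analysis.ValidatedNumerics Literature.Analysis.ValidatedNumerics.PolyMP
  Literature.Analysis.ValidatedNumerics.NumericsMP Literature.Analysis.ValidatedNumerics.ExpPoly
set_option maxRecDepth 200000 in
set_option maxHeartbeats 4000000 in
/-- `z75q1_14_chk`: generated certificate fact (kernel-checked / assembled), cell `RM75Z`. -/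
theorem z75q1_14_chk : dt_edgeCheckL z75S z75c z75m 32 12 z75W (z75gp 1) 40 8 (true, false) (true, false) (true, false) = true := by decide +kernel

set_option maxRecDepth 200000 in
set_option maxHeartbeats 4000000 in
/-- `z75q1_14_le`: generated certificate fact (kernel-checked / assembled), cell `RM75Z`. -/
theorem z75q1_14_le : dt_edgeBoundLQ z75S (z75c / (2 * z75m)) (dt_panelELTM' z75S z75c z75m 32 12 40 8 z75W z75gp z75Mc z75Wd 1 z75V1 (true, false) (true, false) (true, false) z75q1_14LE1 z75q1_14LE2 z75q1_14LP1 z75q1_14LP2 z75q1_14LF1 z75q1_14LF2 15 15) (Poly.shift (z75gp 1) z75c) z75q1_14p z75W.llo z75W.lhi ≤ z75q1_14 := by decide +kernel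

/-- **the edge panel of vector 1**. -/
theorem z75q1_14_bound
    (hRi : IntervalIntegrable (fun ρ ↦
      dt_windowResidual (z75c : ℝ) z75gp z75W.w1 z75W.L1 z75W.w2 z75W.L2 z75W.w3 z75W.L3 (z75Mc : ℝ) (fun a l ↦ (z75Wd a l : ℝ)) 1
        (((PolyMP.panelCentre (z75c / (2 * z75m)) (14) : ℚ) : ℝ) + ρ) ^ 2) volume (-((z75c / (2 * z75m) : ℚ) : ℝ)) ((z75c / (2 * z75m) : ℚ) : ℝ)) :
    ∫ ρ in (-((z75c / (2 * z75m) : ℚ) : ℝ))..((z75c / (2 * z75m) : ℚ) : ℝ),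
        dt_windowResidual (z75c : ℝ) z75gp z75W.w1 z75W.L1 z75W.w2 z75W.L2 z75W.w3 z75W.L3 (z75Mc : ℝ) (fun a l ↦ (z75Wd a l : ℝ)) 1
          (((PolyMP.panelCentre (z75c / (2 * z75m)) (14) : ℚ) : ℝ) + ρ) ^ 2 ≤ ((z75q1_14 : ℚ) : ℝ) := by
  have e : z75m - 1 = 14 := by norm_num [z75m]
  have h := dt_panelQL_edge' (by norm_num [z75S]) (by norm_num [z75c]) z75W (by norm_num [z75m]) (by norm_num [z75c, z75m])
    z75gp z75Mc z75Wd 1 z75V1 (K := 12) (by norm_num) z75q1_14_chk (n1 := 15) (n2 := 15) (by decide)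
    z75q1_14LE1_eq z75q1_14LE2_eq z75q1_14LP1_eq z75q1_14LP2_eq (nf1 := 14) (nf2 := 14) (by norm_num [z75m]) z75q1_14LF1_eq z75q1_14LF2_eq
    (by rw [e]; exact hRi) z75q1_14p
  rw [e] at h
  exact h.trans (by exact_mod_cast z75q1_14_le)
end Summit.RiemannHypothesis.RiemannHypothesis.Theorems.EvenWinsBeyondArch

end
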